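import Summits.BirchSwinnertonDyer.BirchSwinnertonDyer.Theorems.AdditiveBranchIMCTwistRootNumberTwisted
import Literature.NumberTheory.QuadraticFields.KroneckerSplitting
import Literature.NumberTheory.QuadraticFields.FundamentalDiscriminant
import Literature.NumberTheory.EllipticCurves.HeegnerPointsImaginaryQuadraticProofs
import Literature.NumberTheory.EllipticCurves.QuadraticTwistPadicReduction
import HarnessLib

/-!
# `w(E^{(d_K)}) = −w(E)` for a TWISTED ROAD FIELD `K` — the E3′ engine in the field's own currency, first cut (LEAD g15)

Theorems only (no definition, no named fact, no `sorry`). The sketch statement `EngineTwisted` of brick E3′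
(`Cruxes/GordTwoRankOne/TwistedWanSketch.lean` v4; pen memo e19 v6 §4 (g)) reads: for modular `E` whose additive primes `≠ p` are of
quadratic-twist type and an E3′ road field `K` (`TameRoadFieldTwisted W p ℓ₀ K`: `K` imaginary quadratic, the twisted Wan prime `ℓ₀`
RAMIFIED in `K` in the NON-SPLIT CLASS, every other bad prime split, `2` split if `2 ∤ N_E`), `w(E^{(d_K)}) = −w(E)`. This file derives
exactly that, on the FIRST CUT (case A: `W₁ = E^{(ℓ₀*)}` NON-split at `ℓ₀`, so the class clause is `(m/ℓ₀) = +1`; `E` not additive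
at `2`), from the arithmetic engine `TwistRootNumberTwisted.rootNumber_quadraticTwist_eq_neg_of_potMult_caseA` (p796562) by unpacking the
field: `d_K ≡ 1 (mod 8)` because `2` splits (`Quadratic.ncard_primesOver_two_eq_two_iff`), hence `d_K` is odd, fundamental, square-free
(`Quadratic.isFundamentalDiscriminant_discr`); `d_K = ℓ₀*·m` with `m` square-free, `ℓ₀ ∤ m` (`Quadratic.not_sq_dvd_discr_of_prime_ne_two`);
a prime of `m` is ramified, hence not split, hence not a bad prime of `E`; an odd bad prime `v ≠ ℓ₀` splits, so `(d_K/v) = 1`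
(`Quadratic.ncard_primesOver_eq_two_iff_jacobiSym`); `(m/ℓ₀) = +1` makes `m` an `ℓ₀`-adic square; `d_K < 0`. The hypotheses are the
conjuncts of `TameRoadFieldTwisted` UNBUNDLED (the predicate is skeleton vocabulary, not yet a Theorems-side definition).

* `rootNumber_quadraticTwist_discr_eq_neg_of_twistedRoadField_caseA`;
* `quadraticTwist_discr_nonsplit_at_of_caseA` — in case A the rank-one partner `E^{(d_K)} = W₁^{(d_K/ℓ₀*)}` is itself NON-SPLIT
  multiplicative at `ℓ₀` (the class clause in the geometric form the chain's Step L reads; `hasSplitMultiplicativeReductionAtPrime_quadraticTwist_iff`).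

Purpose: the sign input of `stub_fieldOneTwistedR0` (19357 `three_field_road` v37) / `stub_fieldOneTwisted` (19358 v26) in the currency the
field supply produces. BSD is proved for no curve by any of this.
References: [AtkinLi1978] §1, §3; [Rohrlich1993Compositio] Prop. 2–3; [Cox2013] §7.A (fundamental discriminants); [SilvermanAEC2009] VII.5.
-/

set_option linter.dupNamespace false
set_option autoImplicit false

noncomputable section

open scoped Classical

open Literature.NumberTheory.EllipticCurves Literature.NumberTheory.EllipticCurves.ModularForms
  IsDedekindDomain IsDedekindDomain.HeightOneSpectrum NumberField Rat.HeightOneSpectrum WeierstrassCurve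
  Literature.NumberTheory.QuadraticFields
  Summit.BirchSwinnertonDyer.BirchSwinnertonDyer.Theorems

namespace Summit.BirchSwinnertonDyer.BirchSwinnertonDyer.Theorems.TwistRootNumberTwisted

variable (W : WeierstrassCurve ℚ) [W.IsElliptic] [W.IsGloballyMinimal]

/-- **The E3′ engine for a twisted road field, first cut.** For `E / ℚ` (global minimal `W`, modular, odd additive primes of
quadratic-twist type, NOT additive at `2`), an odd prime `ℓ₀` with `E` additive at `ℓ₀` and `W₁ = E^{(ℓ₀*)}` NON-SPLIT multiplicative at
`ℓ₀` (case A), and an imaginary quadratic `K` with `ℓ₀ ∣ d_K`, class `(d_K/ℓ₀* / ℓ₀) = +1`, every bad prime `≠ ℓ₀` of `E` split in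
`K` and `2` split when `2 ∤ N_E`: `w(E^{(d_K)}) = −w(E)` (i.e. `w(E/K) = −1`).
[cite: AtkinLi1978, §1 and §3] [cite: Rohrlich1993Compositio, Prop. 2 (ii)–(iii) and Prop. 3] [cite: Cox2013, §7.A] -/
theorem rootNumber_quadraticTwist_discr_eq_neg_of_twistedRoadField_caseA (hmod : exists_isNewformOf)
    (htt : ∀ p : Nat.Primes, (p : ℕ) ≠ 2 → W.HasAdditiveReductionAt ((primesEquiv (R := ℤ)).symm p) →
      ¬ (W.quadraticTwist (((-1 : ℤ) ^ ((p : ℕ) / 2) * p : ℤ) : ℚ)).HasAdditiveReductionAt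
        ((primesEquiv (R := ℤ)).symm p))
    (h2 : ¬ W.HasAdditiveReductionAt ((primesEquiv (R := ℤ)).symm ⟨2, Nat.prime_two⟩))
    {ℓ₀ : ℕ} [hℓ₀ : Fact ℓ₀.Prime] (hℓ₀2 : ℓ₀ ≠ 2)
    (hadd₀ : W.HasAdditiveReductionAt ((primesEquiv (R := ℤ)).symm ⟨ℓ₀, hℓ₀.out⟩))
    (hmult₀ : (W.quadraticTwist (((-1 : ℤ) ^ (ℓ₀ / 2) * ℓ₀ : ℤ) : ℚ)).HasMultiplicativeReductionAtPrime ℓ₀)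
    (hns₀ : ¬ (W.quadraticTwist (((-1 : ℤ) ^ (ℓ₀ / 2) * ℓ₀ : ℤ) : ℚ)).HasSplitMultiplicativeReductionAtPrime ℓ₀)
    (K : Type) [Field K] [NumberField K] (hK : IsImaginaryQuadratic K)
    (hℓ₀K : (ℓ₀ : ℤ) ∣ NumberField.discr K)
    (hclass : legendreSym ℓ₀ (NumberField.discr K / ((-1 : ℤ) ^ (ℓ₀ / 2) * ℓ₀)) = 1)
    (hsplit : ∀ r : ℕ, r.Prime → r ∣ W.conductorNorm ℤ → r ≠ ℓ₀ → ((Ideal.span {(r : ℤ)}).primesOver (𝓞 K)).ncard = 2)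
    (h2split : ¬ 2 ∣ W.conductorNorm ℤ → ((Ideal.span {(2 : ℤ)}).primesOver (𝓞 K)).ncard = 2) :
    (W.quadraticTwist (NumberField.discr K : ℚ)).rootNumber = -W.rootNumber := by
  set D : ℤ := NumberField.discr K with hD
  set s : ℤ := (-1 : ℤ) ^ (ℓ₀ / 2) * ℓ₀ with hs
  have h2K : Module.finrank ℚ K = 2 := hK.1
  have hDneg : D < 0 := hK.discr_neg
  -- `2` splits in `K`, so `d_K ≡ 1 (mod 8)`
  have h2spl : ((Ideal.span {(2 : ℤ)}).primesOver (𝓞 K)).ncard = 2 := by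
    by_cases h2N : 2 ∣ W.conductorNorm ℤ
    · have h := hsplit 2 Nat.prime_two h2N (Ne.symm hℓ₀2)
      simpa using h
    · exact h2split h2N
  have h8 : D % 8 = 1 := (Quadratic.ncard_primesOver_two_eq_two_iff h2K).mp h2spl
  -- hence `d_K` is odd, fundamental of the first kind: square-free
  have hsqD : Squarefree D := by
    rcases Quadratic.isFundamentalDiscriminant_discr (K := K) h2K with ⟨-, hsq, -⟩ | ⟨h4, -, -⟩
    · exact hsq
    · exfalso
      obtain ⟨c, hc⟩ := h4
      omega
  -- `d_K = ℓ₀* · m`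
  have hsD : s ∣ D := ((isUnit_neg_one (α := ℤ)).pow (ℓ₀ / 2)).mul_left_dvd.mpr hℓ₀K
  set m : ℤ := D / s with hm
  have hDm : D = s * m := (Int.mul_ediv_cancel' hsD).symm
  have hmsq : Squarefree m := hsqD.squarefree_of_dvd ⟨s, by rw [hDm, mul_comm]⟩
  have hℓ₀m : ¬ (ℓ₀ : ℤ) ∣ m := by
    rintro ⟨t, ht⟩
    have hsq : ((ℓ₀ : ℕ) : ℤ) ^ 2 ∣ NumberField.discr K := by
      refine ⟨(-1 : ℤ) ^ (ℓ₀ / 2) * t, ?_⟩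
      rw [← hD, hDm, ht, hs]; ring
    exact Quadratic.not_sq_dvd_discr_of_prime_ne_two h2K hℓ₀.out hℓ₀2 hsq
  -- the primes of `m` are ramified in `K`, hence not split, hence good primes of `E`
  have hgood : ∀ r : Nat.Primes, ((r : ℕ) : ℤ) ∣ m → W.HasGoodReductionAt ((primesEquiv (R := ℤ)).symm r) := by
    intro r hr
    haveI := Fact.mk r.2
    have hrD : ((r : ℕ) : ℤ) ∣ D := by rw [hDm]; exact hr.mul_left _
    have hr2 : (r : ℕ) ≠ 2 := by
      intro h
      rw [h] at hrD
      have : (2 : ℤ) ∣ D := by exact_mod_cast hrD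
      omega
    have hrℓ : (r : ℕ) ≠ ℓ₀ := fun h ↦ hℓ₀m (by rw [← h]; exact hr)
    -- not split: the Legendre symbol of `d_K` at `r ∣ d_K` vanishes
    have hnsplit : ((Ideal.span {((r : ℕ) : ℤ)}).primesOver (𝓞 K)).ncard ≠ 2 := by
      intro h
      have h1 := (Quadratic.ncard_primesOver_eq_two_iff_legendreSym h2K hr2).mp h
      rw [(legendreSym.eq_zero_iff (r : ℕ) (NumberField.discr K)).mpr
        ((ZMod.intCast_zmod_eq_zero_iff_dvd _ _).mpr (by rw [← hD]; exact hrD))] at h1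
      exact zero_ne_one h1
    have hrN : ¬ (r : ℕ) ∣ W.conductorNorm ℤ := fun h ↦ hnsplit (hsplit r r.2 h hrℓ)
    by_contra hbad
    exact hrN ((W.dvd_conductorNorm_iff_not_hasGoodReductionAtPrime r).mpr
      (fun hg ↦ hbad ((W.hasGoodReductionAtPrime_iff_hasGoodReductionAt_holds r).mp hg)))
  -- the odd bad primes `≠ ℓ₀` split: `(d_K/v) = 1`
  have hjac : ∀ p : ℕ, p.Prime → p ∣ W.conductorNorm ℤ → p ≠ 2 → p ≠ ℓ₀ → jacobiSym D p = 1 := fun p hp hpN hp2 hpℓ ↦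
    (Quadratic.ncard_primesOver_eq_two_iff_jacobiSym h2K hp hp2).mp (hsplit p hp hpN hpℓ)
  -- case A: `m` is an `ℓ₀`-adic square
  have hsqA : IsSquare ((m : ℤ) : ℚ_[ℓ₀]) := by
    have hj : jacobiSym m ℓ₀ = 1 := by
      rw [← jacobiSym.legendreSym.to_jacobiSym, hm, hD, hs]
      exact hclass
    exact isSquare_padic_of_jacobiSym_eq_one hℓ₀2 hj
  have h := rootNumber_quadraticTwist_eq_neg_of_potMult_caseA W hmod htt h2 hℓ₀2 hadd₀ hmult₀ hns₀ hDm h8 hDneg hmsq hℓ₀m hgood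
    hjac hsqA
  rwa [hD] at h

omit [W.IsGloballyMinimal] in
/-- **Case A, geometric form of the class clause**: for `K` imaginary quadratic with `ℓ₀ ∣ d_K` and `(d_K/ℓ₀* / ℓ₀) = +1`, and
`W₁ = E^{(ℓ₀*)}` NON-SPLIT multiplicative at the odd prime `ℓ₀`, the twist `E^{(d_K)} = W₁^{(d_K/ℓ₀*)}` — the rank-one partner of the
twisted road — is multiplicative and NOT split at `ℓ₀` (`d_K/ℓ₀*` is an `ℓ₀`-adic unit and square: Matsuno's remark,
`hasSplitMultiplicativeReductionAtPrime_quadraticTwist_iff`). [cite: Matsuno2009, proof of Corollary 6.2 (p. 460)]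
[cite: SilvermanAEC2009, X.5 Cor. 5.4 and VII.5 Prop. 5.1] -/
theorem quadraticTwist_discr_nonsplit_at_of_caseA {ℓ₀ : ℕ} [hℓ₀ : Fact ℓ₀.Prime] (hℓ₀2 : ℓ₀ ≠ 2)
    (hmult₀ : (W.quadraticTwist (((-1 : ℤ) ^ (ℓ₀ / 2) * ℓ₀ : ℤ) : ℚ)).HasMultiplicativeReductionAtPrime ℓ₀)
    (hns₀ : ¬ (W.quadraticTwist (((-1 : ℤ) ^ (ℓ₀ / 2) * ℓ₀ : ℤ) : ℚ)).HasSplitMultiplicativeReductionAtPrime ℓ₀)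
    (K : Type) [Field K] [NumberField K] (hK : IsImaginaryQuadratic K)
    (hℓ₀K : (ℓ₀ : ℤ) ∣ NumberField.discr K)
    (hclass : legendreSym ℓ₀ (NumberField.discr K / ((-1 : ℤ) ^ (ℓ₀ / 2) * ℓ₀)) = 1) :
    (W.quadraticTwist (NumberField.discr K : ℚ)).HasMultiplicativeReductionAtPrime ℓ₀ ∧
      ¬ (W.quadraticTwist (NumberField.discr K : ℚ)).HasSplitMultiplicativeReductionAtPrime ℓ₀ := by
  set D : ℤ := NumberField.discr K with hD
  set s : ℤ := (-1 : ℤ) ^ (ℓ₀ / 2) * ℓ₀ with hs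
  have h2K : Module.finrank ℚ K = 2 := hK.1
  have hs0 : s ≠ 0 := mul_ne_zero (pow_ne_zero _ (by norm_num)) (by exact_mod_cast hℓ₀.out.ne_zero)
  have hsD : s ∣ D := ((isUnit_neg_one (α := ℤ)).pow (ℓ₀ / 2)).mul_left_dvd.mpr hℓ₀K
  set m : ℤ := D / s with hm
  have hDm : D = s * m := (Int.mul_ediv_cancel' hsD).symm
  have hℓ₀m : ¬ (ℓ₀ : ℤ) ∣ m := by
    rintro ⟨t, ht⟩
    have hsq : ((ℓ₀ : ℕ) : ℤ) ^ 2 ∣ NumberField.discr K := by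
      refine ⟨(-1 : ℤ) ^ (ℓ₀ / 2) * t, ?_⟩
      rw [← hD, hDm, ht, hs]; ring
    exact Quadratic.not_sq_dvd_discr_of_prime_ne_two h2K hℓ₀.out hℓ₀2 hsq
  have hm0 : m ≠ 0 := by rintro h; exact hℓ₀m (by rw [h]; exact dvd_zero _)
  have hsqA : IsSquare ((m : ℤ) : ℚ_[ℓ₀]) := by
    have hj : jacobiSym m ℓ₀ = 1 := by
      rw [← jacobiSym.legendreSym.to_jacobiSym, hm, hD, hs]
      exact hclass
    exact isSquare_padic_of_jacobiSym_eq_one hℓ₀2 hj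
  set W₁ := W.quadraticTwist ((s : ℤ) : ℚ) with hW₁
  haveI : W₁.IsElliptic := W.isElliptic_quadraticTwist (show ((s : ℤ) : ℚ) ≠ 0 by exact_mod_cast hs0)
  have hW'W₁ : W₁.quadraticTwist (m : ℚ) = W.quadraticTwist (D : ℚ) := by
    rw [hW₁, quadraticTwist_quadraticTwist, hDm]; push_cast; ring
  set Pℓ : Nat.Primes := ⟨ℓ₀, hℓ₀.out⟩ with hPℓ
  have hmultW₁ : W₁.HasMultiplicativeReductionAt ((primesEquiv (R := ℤ)).symm Pℓ) :=
    (W₁.hasMultiplicativeReductionAtPrime_iff_hasMultiplicativeReductionAt_holds Pℓ).mp hmult₀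
  have hmult' : (W₁.quadraticTwist (m : ℚ)).HasMultiplicativeReductionAt ((primesEquiv (R := ℤ)).symm Pℓ) :=
    ((W₁.hasReductionAt_quadraticTwist_iff_of_not_dvd _
      (by rw [Literature.NumberTheory.EllipticCurves.Rat.natGenerator_primesEquiv_symm]; exact hℓ₀2) (d := m)
      (by rw [Literature.NumberTheory.EllipticCurves.Rat.natGenerator_primesEquiv_symm]; exact hℓ₀m)).2.1).mpr hmultW₁
  haveI : (W₁.quadraticTwist (m : ℚ)).IsElliptic := W₁.isElliptic_quadraticTwist (show (m : ℚ) ≠ 0 by exact_mod_cast hm0)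
  have hmultD : (W₁.quadraticTwist (m : ℚ)).HasMultiplicativeReductionAtPrime ℓ₀ :=
    ((W₁.quadraticTwist (m : ℚ)).hasMultiplicativeReductionAtPrime_iff_hasMultiplicativeReductionAt_holds Pℓ).mpr hmult'
  have hsq' : IsSquare (algebraMap ℚ ℚ_[ℓ₀] (m : ℚ)) := by
    have h : algebraMap ℚ ℚ_[ℓ₀] (m : ℚ) = ((m : ℤ) : ℚ_[ℓ₀]) := by simp
    rw [h]; exact hsqA
  have hnsD : ¬ (W₁.quadraticTwist (m : ℚ)).HasSplitMultiplicativeReductionAtPrime ℓ₀ := fun h ↦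
    hns₀ ((hasSplitMultiplicativeReductionAtPrime_quadraticTwist_iff W₁ (show (m : ℚ) ≠ 0 by exact_mod_cast hm0) hsq').mp h)
  rw [← hW'W₁]
  exact ⟨hmultD, hnsD⟩

end Summit.BirchSwinnertonDyer.BirchSwinnertonDyer.Theorems.TwistRootNumberTwisted

end
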